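import Summits.Langlands.Langlands.Theorems.DyadicOddResidueSectorComplementRigidityTransport
import HarnessLib

/-!
# Transport of the summit along reciprocity data that agree on L-ALGEBRAIC cuspidal `π` only
(crux `AbelianSurfaceSerre.SurfaceSectorComplement`, stmt-Langlands-17767, line `Sketch`;
`--supports` file; no definitions)

The landed transport `ReciprocityRigidity.globalLanglands_transport` /
`langlands_iff_exists_of_rigid` (line `Sketch_18745_r1_k1` of the twin frame stmt-Langlands-18745)
asks for RIGIDITY — two pinned reciprocity data `𝓡`, `𝓡'` of `K` have the same `rec_n` on the
local components of cuspidal automorphic representations of `GL_n(𝔸_K)` — at EVERY cuspidal `π`.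
Both directions of the summit only ever meet L-algebraic `π`: direction (A)
(`AutomorphicToGalois`) is quantified over L-algebraic `π`, and the `π` produced by direction (B)
(`GaloisToAutomorphic`) is L-algebraic by its conclusion.  Hence the transport, and with it
`Langlands ↔ Langlands_∃`, already hold under rigidity restricted to the local components of
L-ALGEBRAIC cuspidal `π` (mutation found by the crux disprover, `Cruxes/SurfaceSectorComplement/
Disproof.lean` §6, `crux_of_stubs_weak`; this file lands it so that the line's skeleton imports it):

* `automorphicToGalois_transport_of_isLAlgebraic`, `galoisToAutomorphic_transport_of_isLAlgebraic`,
  `globalLanglands_transport_of_isLAlgebraic` — direction-wise and joint transport in rank `n`;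
* `langlands_iff_exists_of_rigid_lAlgebraic` — under the restricted rigidity Rʷ,
  `Langlands ↔ Langlands_∃` (`Langlands_∃ := ∀ F, ∃ 𝓡, ∀ n > 0, ∀ hcpt, (A) ∧ (B)`, spelled out);
* `rigid_lAlgebraic_of_rigid` — R (as consumed by `langlands_iff_exists_of_rigid`) gives Rʷ, so
  the line's stub S1ʷ is served verbatim by the twin line's lever R when that lands.

The restriction matters for the bookkeeping of the frame items: Rʷ is a consequence of the summit
modulo Chebotarev density + Brauer–Nesbitt (for L-algebraic `π`, (A) for `𝓡` and for `𝓡'` give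
Galois representations with the same Frobenius traces a.e.), whereas R also speaks about the
non-algebraic cuspidal spectrum, on which the summit is silent.  Pure logic over the accepted
statement; standard axioms; nothing positive is asserted unconditionally.

References: G. Henniart, Invent. Math. 113 (1993), Thm. 1.1 (uniqueness of the local
correspondence — the content of R/Rʷ in print); K. Buzzard, T. Gee, LMS LNS 414 (2014),
Conj. 3.2.1–3.2.2 (L-algebraic `π`).
-/

noncomputable section

set_option linter.dupNamespace false -- project-wide option; `Summit.Langlands.Langlands` is the mandated namespace

open scoped MatrixGroups NumberField
open NumberField IsDedekindDomain
open Literature.NumberTheory.Automorphic Literature.NumberTheory.GaloisRepresentations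
open Summit.Langlands

namespace Summit.Langlands.Langlands.Theorems.ReciprocityRigidity

section Transport

variable {K : Type} [Field K] [NumberField K] {n : ℕ} {hcpt : isCompact_glFiniteIntegralLevel n K}

/-- **Transport of direction (A) in rank `n`** along two reciprocity data that agree on the local
components of every L-ALGEBRAIC cuspidal `π` of `GL_n(𝔸_K)` ((A) is quantified over L-algebraic
`π`; `IsGeometricFramed` reads the pinned `p`-adic Hodge datum only; the uniqueness clause is
transported backwards). [folklore] -/
theorem automorphicToGalois_transport_of_isLAlgebraic (𝓡 𝓡' : ReciprocityData K)
    (h : ∀ π : CuspidalAutomorphicRepData n K hcpt, π.1.IsLAlgebraic →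
      ∀ (v : HeightOneSpectrum (𝓞 K)) (πv : SmoothIrrep (GL (Fin n) (v.adicCompletion K))),
        π.1.HasLocalComponentAt v πv.ρ →
          (𝓡.llc v).recGL n (IrrClass.mk πv) = (𝓡'.llc v).recGL n (IrrClass.mk πv))
    (hA : AutomorphicToGalois n 𝓡 hcpt) : AutomorphicToGalois n 𝓡' hcpt := by
  intro π hLalg ℓ _ ι
  obtain ⟨ρ, hirr, hgeo, hcorr, huniq⟩ := hA π hLalg ℓ ι
  exact ⟨ρ, hirr, hgeo, corresponds_transport 𝓡 𝓡' ι π ρ (h π hLalg) hcorr,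
    fun ρ' hcorr' ↦ huniq ρ' (corresponds_transport 𝓡' 𝓡 ι π ρ'
      (fun v πv hπv ↦ (h π hLalg v πv hπv).symm) hcorr')⟩

/-- **Transport of direction (B) in rank `n`** along two reciprocity data that agree on the local
components of every L-algebraic cuspidal `π` (the `π` produced by (B) is L-algebraic by its
conclusion). [folklore] -/
theorem galoisToAutomorphic_transport_of_isLAlgebraic (𝓡 𝓡' : ReciprocityData K)
    (h : ∀ π : CuspidalAutomorphicRepData n K hcpt, π.1.IsLAlgebraic →
      ∀ (v : HeightOneSpectrum (𝓞 K)) (πv : SmoothIrrep (GL (Fin n) (v.adicCompletion K))),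
        π.1.HasLocalComponentAt v πv.ρ →
          (𝓡.llc v).recGL n (IrrClass.mk πv) = (𝓡'.llc v).recGL n (IrrClass.mk πv))
    (hB : GaloisToAutomorphic n 𝓡 hcpt) : GaloisToAutomorphic n 𝓡' hcpt := by
  intro ℓ _ ι ρ hirr hgeo
  obtain ⟨π, hLalg, hcorr⟩ := hB ℓ ι ρ hirr hgeo
  exact ⟨π, hLalg, corresponds_transport 𝓡 𝓡' ι π ρ (h π hLalg) hcorr⟩

/-- **Transport of the whole correspondence `(A) ∧ (B)` in rank `n`** along two reciprocity data
that agree on the local components of every L-algebraic cuspidal `π` of `GL_n(𝔸_K)`. [folklore] -/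
theorem globalLanglands_transport_of_isLAlgebraic (𝓡 𝓡' : ReciprocityData K)
    (h : ∀ π : CuspidalAutomorphicRepData n K hcpt, π.1.IsLAlgebraic →
      ∀ (v : HeightOneSpectrum (𝓞 K)) (πv : SmoothIrrep (GL (Fin n) (v.adicCompletion K))),
        π.1.HasLocalComponentAt v πv.ρ →
          (𝓡.llc v).recGL n (IrrClass.mk πv) = (𝓡'.llc v).recGL n (IrrClass.mk πv))
    (hG : GlobalLanglandsCorrespondenceGLn n K 𝓡 hcpt) :
    GlobalLanglandsCorrespondenceGLn n K 𝓡' hcpt :=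
  ⟨automorphicToGalois_transport_of_isLAlgebraic 𝓡 𝓡' h hG.1,
    galoisToAutomorphic_transport_of_isLAlgebraic 𝓡 𝓡' h hG.2⟩

end Transport

/-- **Under rigidity on L-algebraic cuspidal `π`, `Langlands ↔ Langlands_∃`.**  Hypothesis
`hR` = Rʷ spelled out: any two pinned reciprocity data of a number field agree on the local
components of the L-algebraic cuspidal automorphic representations, in every rank `n ≥ 1`
(in print: Henniart 1993, Thm. 1.1, local components being generic; it is implied by the
unrestricted rigidity R, `rigid_lAlgebraic_of_rigid`). [cite: Henniarts1993, Thm 1.1] -/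
theorem langlands_iff_exists_of_rigid_lAlgebraic
    (hR : ∀ (K : Type) [Field K] [NumberField K] (𝓡 𝓡' : ReciprocityData K) (n : ℕ)
      (hcpt : isCompact_glFiniteIntegralLevel n K), 0 < n →
      ∀ π : CuspidalAutomorphicRepData n K hcpt, π.1.IsLAlgebraic →
        ∀ (v : HeightOneSpectrum (𝓞 K)) (πv : SmoothIrrep (GL (Fin n) (v.adicCompletion K))),
          π.1.HasLocalComponentAt v πv.ρ →
            (𝓡.llc v).recGL n (IrrClass.mk πv) = (𝓡'.llc v).recGL n (IrrClass.mk πv)) :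
    _root_.Langlands ↔
      ∀ (F : Type) [Field F] [NumberField F], ∃ 𝓡 : ReciprocityData F, ∀ n : ℕ, 0 < n →
        ∀ hcpt : isCompact_glFiniteIntegralLevel n F, GlobalLanglandsCorrespondenceGLn n F 𝓡 hcpt := by
  constructor
  · intro hL F _ _
    obtain ⟨⟨𝓡⟩, hall⟩ := hL F
    exact ⟨𝓡, hall 𝓡⟩
  · intro hE F _ _
    obtain ⟨𝓡, h𝓡⟩ := hE F
    exact ⟨⟨𝓡⟩, fun 𝓡' n hn hcpt ↦
      globalLanglands_transport_of_isLAlgebraic 𝓡 𝓡' (hR F 𝓡 𝓡' n hcpt hn) (h𝓡 n hn hcpt)⟩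

/-- **R gives Rʷ**: the unrestricted rigidity hypothesis of `langlands_iff_exists_of_rigid` (the
lever of the twin line on stmt-Langlands-18745) implies the restricted one, by discarding
`IsLAlgebraic`. [folklore] -/
theorem rigid_lAlgebraic_of_rigid
    (hR : ∀ (K : Type) [Field K] [NumberField K] (𝓡 𝓡' : ReciprocityData K) (n : ℕ)
      (hcpt : isCompact_glFiniteIntegralLevel n K), 0 < n →
      ∀ (π : CuspidalAutomorphicRepData n K hcpt) (v : HeightOneSpectrum (𝓞 K))
        (πv : SmoothIrrep (GL (Fin n) (v.adicCompletion K))), π.1.HasLocalComponentAt v πv.ρ →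
          (𝓡.llc v).recGL n (IrrClass.mk πv) = (𝓡'.llc v).recGL n (IrrClass.mk πv)) :
    ∀ (K : Type) [Field K] [NumberField K] (𝓡 𝓡' : ReciprocityData K) (n : ℕ)
      (hcpt : isCompact_glFiniteIntegralLevel n K), 0 < n →
      ∀ π : CuspidalAutomorphicRepData n K hcpt, π.1.IsLAlgebraic →
        ∀ (v : HeightOneSpectrum (𝓞 K)) (πv : SmoothIrrep (GL (Fin n) (v.adicCompletion K))),
          π.1.HasLocalComponentAt v πv.ρ →
            (𝓡.llc v).recGL n (IrrClass.mk πv) = (𝓡'.llc v).recGL n (IrrClass.mk πv) :=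
  fun K _ _ 𝓡 𝓡' n hcpt hn π _ v πv hπv ↦ hR K 𝓡 𝓡' n hcpt hn π v πv hπv

end Summit.Langlands.Langlands.Theorems.ReciprocityRigidity

end
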